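import Summits.NavierStokesRegularity.NavierStokesRegularity.Theorems.SwirlFreeBudget
import Literature.Analysis.PDE.GiaquintaIterationLemma
import HarnessLib

/-!
# SwirlFreeBudget, toward crux K-18.1 `EtaMoserBound` (T-18.2): the `p < 2` absorption step of
# Moser's iteration (memo Appendix A.6–A.7), PROVED as a generic real-analysis lemma (seat nsreg-p4 g12)

Support file for the DORMANT route `SwirlThreshold` (crux stmt-NavierStokesRegularity-2002) and
planner nsreg-p2's ROUND-18 Appendix A (`R18-APPENDIX-EtaMoser.md`, referee-grade proof of
`EtaMoserBound`).  Step A.6 there lowers the start exponent of the `L² → L^∞` Moser bound below `1`: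
if `f(ρ) = sup_{Q(z₁,ρ)} |η|` satisfies `f(ρ) ≤ X (ρ' - ρ)^{-α} f(ρ')^{1 - p/2}` for
`a ≤ ρ < ρ' ≤ b` (`X = K₀ I_p^{1/2}`, `α = 5`, `0 < p < 2`) and is bounded, then
`f(a) ≤ c_p X^{2/p} (b - a)^{-2α/p}`.  This file proves exactly that, for an arbitrary function `f`:

* `rpow_young_pLtTwo` — Young's inequality in the form used:
  `Z · u^{1-p/2} ≤ (p/2) Z^{2/p} + (1 - p/2) u` (`Z, u ≥ 0`, `0 < p < 2`);
* `moser_absorb_pLtTwo` — **the absorption lemma**: `0 ≤ f ≤ L` on `[a, b]` and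
  `f(s) ≤ X (t - s)^{-α} f(t)^{1-p/2}` for `a ≤ s < t ≤ b` imply
  `f(a) ≤ c · X^{2/p} / (b - a)^{2α/p}` with `c = c(p, α)` (Young with `θ = 1 - p/2 < 1`, then
  Giaquinta's iteration lemma `Literature.Analysis.PDE.Giaquinta1983.lemma_V_3_1` with `B = 0`).

WHAT THIS IS NOT: not NS regularity — elementary real analysis (one brick of the η-Moser iteration;
`EtaMoserBound` itself stays OPEN); no crux claim.
-/

namespace Summit.NavierStokesRegularity.NavierStokesRegularity.Theorems.SwirlFreeBudget

open Set

noncomputable section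

/-- **Young's inequality, `p < 2` form.**  For `0 < p < 2` and `Z, u ≥ 0`:
`Z · u^{1 - p/2} ≤ (p/2) · Z^{2/p} + (1 - p/2) · u` (exponents `2/p` and `2/(2-p)`). -/
theorem rpow_young_pLtTwo {p Z u : ℝ} (hp0 : 0 < p) (hp2 : p < 2) (hZ : 0 ≤ Z) (hu : 0 ≤ u) :
    Z * u ^ (1 - p / 2) ≤ p / 2 * Z ^ (2 / p) + (1 - p / 2) * u := by
  have ha : 0 < p / 2 := by positivity
  have hb : 0 < 1 - p / 2 := by linarith
  have hab : p / 2 + (1 - p / 2) = 1 := by ring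
  have hconj : (p / 2)⁻¹.HolderConjugate (1 - p / 2)⁻¹ := Real.HolderConjugate.inv_inv ha hb hab
  have hy := Real.young_inequality_of_nonneg hZ (Real.rpow_nonneg hu (1 - p / 2)) hconj
  have e1 : (p / 2)⁻¹ = 2 / p := by rw [inv_div]
  have e2 : (u ^ (1 - p / 2)) ^ (1 - p / 2)⁻¹ = u := by
    rw [← Real.rpow_mul hu, mul_inv_cancel₀ hb.ne', Real.rpow_one]
  rw [e1, e2] at hy
  calc Z * u ^ (1 - p / 2) ≤ Z ^ (2 / p) / (2 / p) + u / (1 - p / 2)⁻¹ := hy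
    _ = p / 2 * Z ^ (2 / p) + (1 - p / 2) * u := by
        rw [div_inv_eq_mul]
        field_simp

/-- **The `p < 2` absorption step of Moser's iteration** (memo R18 Appendix A.6; DiBenedetto /
Han–Lin Lemma 4.3 type).  Let `0 < p < 2`, `α > 0`.  There is `c = c(p, α) > 0` such that for all
`a < b`, `X ≥ 0` and every `f` with `0 ≤ f ≤ L` on `[a, b]` and
`f(s) ≤ X / (t - s)^α · f(t)^{1 - p/2}` whenever `a ≤ s < t ≤ b`, one has
`f(a) ≤ c · X^{2/p} / (b - a)^{2α/p}` — the a-priori bound `L` has disappeared. -/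
theorem moser_absorb_pLtTwo {p α : ℝ} (hp0 : 0 < p) (hp2 : p < 2) (hα : 0 < α) :
    ∃ c : ℝ, 0 < c ∧ ∀ (f : ℝ → ℝ) (a b X L : ℝ), a < b → 0 ≤ X →
      (∀ s ∈ Icc a b, 0 ≤ f s) → (∀ s ∈ Icc a b, f s ≤ L) →
      (∀ s t : ℝ, a ≤ s → s < t → t ≤ b → f s ≤ X / (t - s) ^ α * f t ^ (1 - p / 2)) →
      f a ≤ c * X ^ (2 / p) / (b - a) ^ (2 * α / p) := by
  have hθ0 : 0 ≤ 1 - p / 2 := by linarith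
  have hθ1 : 1 - p / 2 < 1 := by linarith
  have hα' : 0 < 2 * α / p := by positivity
  obtain ⟨c, hc, hG⟩ := Literature.Analysis.PDE.Giaquinta1983.lemma_V_3_1 hθ0 hθ1 hα'
  refine ⟨c * (p / 2), by positivity, ?_⟩
  intro f a b X L hab hX hf0 hfL h
  -- Young: `f(s) ≤ (p/2) X^{2/p} / (t-s)^{2α/p} + (1 - p/2) f(t)`
  have hstep : ∀ s t : ℝ, a ≤ s → s < t → t ≤ b →
      f s ≤ (p / 2 * X ^ (2 / p) / (t - s) ^ (2 * α / p) + 0) + (1 - p / 2) * f t := by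
    intro s t hs hst ht
    have hts : 0 < t - s := by linarith
    have hft : 0 ≤ f t := hf0 t ⟨by linarith, ht⟩
    have hZ : 0 ≤ X / (t - s) ^ α := div_nonneg hX (Real.rpow_nonneg hts.le _)
    have hy := rpow_young_pLtTwo hp0 hp2 hZ hft
    have e : (X / (t - s) ^ α) ^ (2 / p) = X ^ (2 / p) / (t - s) ^ (2 * α / p) := by
      rw [Real.div_rpow hX (Real.rpow_nonneg hts.le _), ← Real.rpow_mul hts.le]
      congr 2; ring
    calc f s ≤ X / (t - s) ^ α * f t ^ (1 - p / 2) := h s t hs hst ht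
      _ ≤ p / 2 * (X / (t - s) ^ α) ^ (2 / p) + (1 - p / 2) * f t := hy
      _ = (p / 2 * X ^ (2 / p) / (t - s) ^ (2 * α / p) + 0) + (1 - p / 2) * f t := by
          rw [e]; ring
  have hA : 0 ≤ p / 2 * X ^ (2 / p) := by positivity
  have key := hG f a b (p / 2 * X ^ (2 / p)) 0 L hA le_rfl hfL hstep a b le_rfl hab le_rfl
  calc f a ≤ c * (p / 2 * X ^ (2 / p) / (b - a) ^ (2 * α / p) + 0) := key
    _ = c * (p / 2) * X ^ (2 / p) / (b - a) ^ (2 * α / p) := by ring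

end

end Summit.NavierStokesRegularity.NavierStokesRegularity.Theorems.SwirlFreeBudget
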